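import Mathlib.NumberTheory.ModularForms.CongruenceSubgroups
import Mathlib.GroupTheory.Transfer
import Mathlib.GroupTheory.Commutator.Basic
import Mathlib.LinearAlgebra.Matrix.FixedDetMatrices
import Mathlib.GroupTheory.Schreier
import Mathlib.GroupTheory.FiniteAbelian.Basic
import HarnessLib

/-!
# K★ `StarredOptimalManinUnitFiveSeven` — line `cdt_thm1`, stub `stub_hcor_invariant`: reduction to «`[SL₂(ℤ), Γ(N)]` is a congruence subgroup»

Crux K★ (stmt-BirchSwinnertonDyer-22226), skeleton `Cruxes/StarredOptimalManinUnitFiveSeven/Lines/cdt_thm1.lean`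
v16: after `stub_hker2` (p820946) the ONE remaining stub is `stub_hcor_invariant` = CDT Cor. 4.5.3 in
invariant form («every `SL₂(ℤ)`-conjugation-invariant homomorphism `Γ(N) → Q`, `Q` finite abelian, is
trivial on some `Γ(M)`»).  This SUPPORT file (no stub is closed here) records two kernel-checked facts
that pin down what is left:

* `apply_eq_one_of_mem_commutator`, `hcor_invariant_of_commutator_congruence` — an invariant `θ`
  kills the commutator subgroup `[SL₂(ℤ), Γ(N)]`, so the stub FOLLOWS from the purely group-theoretic
  sentence «for every `N ≥ 1` there is `M ≠ 0` with `Γ(M) ∩ Γ(N) ≤ [SL₂(ℤ), Γ(N)]`» (and is equivalent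
  to it: apply the stub to `Γ(N) → Γ(N)/[SL₂(ℤ), Γ(N)]`, finite abelian by the next item and
  Schreier).  By Hopf's formula with `H₂(SL₂(ℤ), ℤ) = 0` the obstruction is the Schur multiplier
  `H₂(SL₂(ℤ/N), ℤ) ≅ (Γ(N) ∩ SL₂(ℤ)')/[SL₂(ℤ), Γ(N)]` (`= 0` for `4 ∤ N`, `ℤ/2` for `4 ∣ N`, Beyl 1986),
  which is where CDT Thm. 4.5.2 (`H̃¹(𝐅_ℓ)^{SL₂(ℤ̂)} = 0`, Lazard + a MAGMA computation at `N = 8, 16`)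
  enters; the expected level is `M = lcm(12, 2N)`.
* `exists_T_pow_mem_commutator`, `conj_T_pow_mem_commutator` — the quotient
  `E = SL₂(ℤ)/[SL₂(ℤ), Γ(N)]` is a central extension of `SL₂(ℤ/N)`; the TRANSFER to its centre
  (`MonoidHom.transferCenterPow`, `g ↦ g^{[E:Z(E)]}`) and the relations `S⁴ = 1`, `(ST)³ = S²` give
  `T^{12 [E:Z(E)]} ∈ [SL₂(ℤ), Γ(N)]`, hence all conjugates of that power of `T`: the commutator subgroup
  contains the normal closure `Δ(m)` of `T^m` for some `m ≥ 1` (its Wohlfahrt level is finite).  What is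
  NOT proved is the step from `Δ(m) ≤ [SL₂(ℤ), Γ(N)]` to `Γ(M) ≤ [SL₂(ℤ), Γ(N)]` — for a NON-congruence
  normal subgroup of level `m` this fails, and deciding it for `[SL₂(ℤ), Γ(N)]` is exactly the
  Schur-multiplier computation above.

* (appendix, second instalment) `exists_pow_mem_commutator` (a UNIFORM exponent: `g^m ∈ [SL₂(ℤ), Γ(N)]` for all
  `g`, via `SL₂(ℤ) = ⟨S, T⟩`, Mathlib `SpecialLinearGroup.SL2Z_generators`), `commutator_finiteIndex`
  (`[SL₂(ℤ), Γ(N)]` has FINITE INDEX: `Γ(N)/[SL₂(ℤ),Γ(N)]` is finitely generated abelian of finite exponent —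
  Schreier + `CommGroup.finite_of_fg_torsion`), and the CONVERSE reduction
  `commutator_congruence_of_hcor_invariant`: the stub implies «`Γ(M) ∩ Γ(N) ≤ [SL₂(ℤ), Γ(N)]`», so the two
  sentences are EQUIVALENT and the planner may file either as the one printed input.

K★ stays OPEN; BSD is not proved; Manin's conjecture is not proved; nothing here closes the stub.
[cite: CalegariDimitrovTang2025, Theorem 4.5.2 and Corollary 4.5.3] [cite: Serre1980Trees, II.1.4]
-/

set_option autoImplicit false
set_option linter.dupNamespace false

noncomputable section

open scoped MatrixGroups
open CongruenceSubgroup Matrix.SpecialLinearGroup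

namespace Summit.BirchSwinnertonDyer.BirchSwinnertonDyer.Theorems.StarredOptimalManinUnitFiveSevenHcorReduction

/-! ### Conjugation-invariant homomorphisms kill `[SL₂(ℤ), Γ(N)]` -/

/-- An `SL₂(ℤ)`-conjugation-invariant homomorphism `θ : Γ(N) → Q` is trivial on the commutator
subgroup `[SL₂(ℤ), Γ(N)]` (which lies in `Γ(N)` by normality): `θ(g x g⁻¹ x⁻¹) = θ(g x g⁻¹) θ(x)⁻¹ = 1`.
[cite: CalegariDimitrovTang2025, Corollary 4.5.3 (reformulation)] -/
theorem apply_eq_one_of_mem_commutator {N : ℕ} {Q : Type*} [Group Q] (θ : Gamma N →* Q)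
    (hθ : ∀ (g x : SL(2, ℤ)) (hx : x ∈ Gamma N) (hgx : g * x * g⁻¹ ∈ Gamma N),
      θ ⟨g * x * g⁻¹, hgx⟩ = θ ⟨x, hx⟩)
    {x : SL(2, ℤ)} (hxC : x ∈ ⁅(⊤ : Subgroup SL(2, ℤ)), Gamma N⁆) (hx : x ∈ Gamma N) :
    θ ⟨x, hx⟩ = 1 := by
  -- closure induction over the generating commutators
  have key : ∀ y ∈ ⁅(⊤ : Subgroup SL(2, ℤ)), Gamma N⁆, ∀ hy : y ∈ Gamma N, θ ⟨y, hy⟩ = 1 := by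
    intro y hy
    rw [Subgroup.commutator_def] at hy
    refine Subgroup.closure_induction (p := fun y _ ↦ ∀ hy : y ∈ Gamma N, θ ⟨y, hy⟩ = 1)
      ?_ ?_ ?_ ?_ hy
    · rintro _ ⟨g, -, z, hz, rfl⟩
      have hgz : g * z * g⁻¹ ∈ Gamma N := (Gamma_normal N).conj_mem z hz g
      change ∀ hmem' : g * z * g⁻¹ * z⁻¹ ∈ Gamma N, θ ⟨g * z * g⁻¹ * z⁻¹, hmem'⟩ = 1 at *
      intro hmem'
      have : (⟨g * z * g⁻¹ * z⁻¹, hmem'⟩ : Gamma N) = ⟨g * z * g⁻¹, hgz⟩ * ⟨z, hz⟩⁻¹ := rfl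
      rw [this, map_mul, map_inv, hθ g z hz hgz, mul_inv_cancel]
    · intro h1
      have : (⟨1, h1⟩ : Gamma N) = 1 := rfl
      rw [this, map_one]
    · intro a b ha hb iha ihb hab
      haveI := Gamma_normal N
      have ha' : a ∈ Gamma N := by
        rw [← Subgroup.commutator_def] at ha; exact Subgroup.commutator_le_right _ _ ha
      have hb' : b ∈ Gamma N := by
        rw [← Subgroup.commutator_def] at hb; exact Subgroup.commutator_le_right _ _ hb
      have : (⟨a * b, hab⟩ : Gamma N) = ⟨a, ha'⟩ * ⟨b, hb'⟩ := rfl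
      rw [this, map_mul, iha ha', ihb hb', one_mul]
    · intro a ha iha hainv
      haveI := Gamma_normal N
      have ha' : a ∈ Gamma N := by
        rw [← Subgroup.commutator_def] at ha; exact Subgroup.commutator_le_right _ _ ha
      have : (⟨a⁻¹, hainv⟩ : Gamma N) = ⟨a, ha'⟩⁻¹ := rfl
      rw [this, map_inv, iha ha', inv_one]
  exact key x hxC hx

/-- **Reduction of `stub_hcor_invariant` to a statement about `SL₂(ℤ)` alone.** If for every level
`N ≥ 1` the commutator subgroup `[SL₂(ℤ), Γ(N)]` contains `Γ(M) ∩ Γ(N)` for some `M ≠ 0` (i.e. is a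
congruence subgroup), then every `SL₂(ℤ)`-invariant homomorphism `Γ(N) → Q` is trivial on some
`Γ(M)` — verbatim the registered stub `stub_hcor_invariant` of the line `cdt_thm1` (CDT Cor. 4.5.3 in
invariant form). [cite: CalegariDimitrovTang2025, Corollary 4.5.3 and Theorem 4.5.2] -/
theorem hcor_invariant_of_commutator_congruence
    (h : ∀ N : ℕ, 0 < N → ∃ M : ℕ, M ≠ 0 ∧ Gamma M ⊓ Gamma N ≤ ⁅(⊤ : Subgroup SL(2, ℤ)), Gamma N⁆) :
    ∀ (N : ℕ) (Q : Type) [CommGroup Q] [Finite Q] (θ : Gamma N →* Q),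
      (∀ (g x : SL(2, ℤ)) (hx : x ∈ Gamma N) (hgx : g * x * g⁻¹ ∈ Gamma N),
        θ ⟨g * x * g⁻¹, hgx⟩ = θ ⟨x, hx⟩) →
      ∃ M : ℕ, M ≠ 0 ∧ ∀ (x : SL(2, ℤ)) (hx : x ∈ Gamma N), x ∈ Gamma M → θ ⟨x, hx⟩ = 1 := by
  intro N Q _ _ θ hθ
  rcases Nat.eq_zero_or_pos N with rfl | hN
  · refine ⟨1, one_ne_zero, fun x hx _ ↦ ?_⟩
    have hx1 : x = 1 := by simpa [Gamma_zero_bot] using hx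
    subst hx1
    have : (⟨1, hx⟩ : Gamma 0) = 1 := rfl
    rw [this, map_one]
  · obtain ⟨M, hM, hle⟩ := h N hN
    exact ⟨M, hM, fun x hx hxM ↦ apply_eq_one_of_mem_commutator θ hθ (hle ⟨hxM, hx⟩) hx⟩

/-! ### The quotient `SL₂(ℤ)/[SL₂(ℤ), Γ(N)]` has finite exponent on `T`: a transfer argument -/

/-- **`T^m ∈ [SL₂(ℤ), Γ(N)]` for some `m ≥ 1`** (`N ≥ 1`).  In `E = SL₂(ℤ)/[SL₂(ℤ), Γ(N)]` the image of
`Γ(N)` is central of finite index, so the transfer `V : E → Z(E)`, `V(g) = g^{[E:Z(E)]}`, is defined;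
the relations `S⁴ = 1`, `(ST)³ = S²` force `V(T)¹² = 1`, i.e. `T^{12 [E : Z(E)]} ∈ [SL₂(ℤ), Γ(N)]`.
Hence all `SL₂(ℤ)`-conjugates of that power of `T` lie in `[SL₂(ℤ), Γ(N)]` (which is normal).
[cite: CalegariDimitrovTang2025, §4.5 (the role of `H₂(SL₂(ℤ)) = 0`, `SL₂(ℤ)ᵃᵇ = ℤ/12`)] -/
theorem exists_T_pow_mem_commutator (N : ℕ) (hN : 0 < N) :
    ∃ m : ℕ, 0 < m ∧ ModularGroup.T ^ m ∈ ⁅(⊤ : Subgroup SL(2, ℤ)), Gamma N⁆ := by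
  haveI : NeZero N := ⟨hN.ne'⟩
  haveI := Gamma_normal N
  set C : Subgroup SL(2, ℤ) := ⁅(⊤ : Subgroup SL(2, ℤ)), Gamma N⁆ with hC
  haveI hCn : C.Normal := Subgroup.commutator_normal _ _
  -- the image of `Γ(N)` in `E = SL₂(ℤ)/C` is central
  have hcent : (Gamma N).map (QuotientGroup.mk' C) ≤ Subgroup.center (SL(2, ℤ) ⧸ C) := by
    rintro _ ⟨x, hx, rfl⟩
    rw [Subgroup.mem_center_iff]
    intro e
    obtain ⟨g, rfl⟩ := QuotientGroup.mk'_surjective C e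
    have hc : g * x * g⁻¹ * x⁻¹ ∈ C := Subgroup.commutator_mem_commutator (Subgroup.mem_top g) hx
    have h1 : QuotientGroup.mk' C (g * x * g⁻¹ * x⁻¹) = 1 := (QuotientGroup.eq_one_iff _).mpr hc
    rw [map_mul, map_mul, map_mul, map_inv, map_inv] at h1
    calc QuotientGroup.mk' C g * QuotientGroup.mk' C x
        = (QuotientGroup.mk' C g * QuotientGroup.mk' C x * (QuotientGroup.mk' C g)⁻¹ *
            (QuotientGroup.mk' C x)⁻¹) * (QuotientGroup.mk' C x * QuotientGroup.mk' C g) := by group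
      _ = QuotientGroup.mk' C x * QuotientGroup.mk' C g := by rw [h1, one_mul]
  -- hence the center has finite index
  haveI : (Subgroup.center (SL(2, ℤ) ⧸ C)).FiniteIndex := by
    haveI : ((Gamma N).map (QuotientGroup.mk' C)).FiniteIndex := by
      refine ⟨fun h0 ↦ ?_⟩
      have hd := Subgroup.index_map_dvd (Gamma N) (QuotientGroup.mk'_surjective C)
      rw [h0, zero_dvd_iff] at hd
      exact (Gamma N).index_ne_zero_of_finite hd
    exact Subgroup.finiteIndex_of_le hcent
  -- the transfer `V : E → Z(E)`, `V g = g ^ k`, is a homomorphism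
  set k : ℕ := (Subgroup.center (SL(2, ℤ) ⧸ C)).index with hk
  have hk0 : 0 < k := Nat.pos_of_ne_zero Subgroup.FiniteIndex.index_ne_zero
  let V : (SL(2, ℤ) ⧸ C) →* Subgroup.center (SL(2, ℤ) ⧸ C) := MonoidHom.transferCenterPow (SL(2, ℤ) ⧸ C)
  have hV : ∀ g, ((V g : Subgroup.center (SL(2, ℤ) ⧸ C)) : SL(2, ℤ) ⧸ C) = g ^ k :=
    MonoidHom.transferCenterPow_apply
  have hpow_mul : ∀ g h : SL(2, ℤ) ⧸ C, (g * h) ^ k = g ^ k * h ^ k := fun g h ↦ by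
    have := congrArg Subtype.val (map_mul V g h)
    simpa only [hV, Subgroup.coe_mul] using this
  have hcen : ∀ g : SL(2, ℤ) ⧸ C, g ^ k ∈ Subgroup.center (SL(2, ℤ) ⧸ C) := fun g ↦ by
    rw [← hV]; exact (V g).2
  -- relations of `SL₂(ℤ)`: `S⁴ = 1`, `(S T)³ = S²`
  have hS4 : (ModularGroup.S : SL(2, ℤ)) ^ 4 = 1 := by
    ext i j; fin_cases i <;> fin_cases j <;> simp [pow_succ, ModularGroup.S, Matrix.mul_apply, Fin.sum_univ_two]
  have hST : (ModularGroup.S * ModularGroup.T : SL(2, ℤ)) ^ 3 = ModularGroup.S ^ 2 := by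
    ext i j; fin_cases i <;> fin_cases j <;>
      simp [pow_succ, ModularGroup.S, ModularGroup.T, Matrix.mul_apply, Fin.sum_univ_two]
  set s : SL(2, ℤ) ⧸ C := QuotientGroup.mk' C ModularGroup.S with hs
  set t : SL(2, ℤ) ⧸ C := QuotientGroup.mk' C ModularGroup.T with ht
  have hs4 : s ^ 4 = 1 := by rw [hs, ← map_pow, hS4, map_one]
  have hst : (s * t) ^ 3 = s ^ 2 := by rw [hs, ht, ← map_mul, ← map_pow, hST, map_pow]
  -- `a = s^k`, `b = t^k` are central, `(a b)^3 = a^2`, `a^4 = 1`, hence `b^12 = 1`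
  have comm : Commute (s ^ k) (t ^ k) := (Subgroup.mem_center_iff.mp (hcen t) (s ^ k))
  have hab : (s ^ k) ^ 3 * (t ^ k) ^ 3 = (s ^ k) ^ 2 := by
    rw [← comm.mul_pow, ← hpow_mul, ← pow_mul, mul_comm k 3, pow_mul, hst, ← pow_mul, ← pow_mul,
      mul_comm 2 k]
  have ha4 : (s ^ k) ^ 4 = 1 := by rw [← pow_mul, mul_comm, pow_mul, hs4, one_pow]
  have hb3 : (t ^ k) ^ 3 = (s ^ k)⁻¹ := by
    rw [show (t ^ k) ^ 3 = ((s ^ k) ^ 3)⁻¹ * ((s ^ k) ^ 3 * (t ^ k) ^ 3) by group, hab]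
    group
  have hb12 : t ^ (12 * k) = 1 := by
    calc t ^ (12 * k) = ((t ^ k) ^ 3) ^ 4 := by rw [← pow_mul, ← pow_mul]; ring_nf
      _ = 1 := by rw [hb3, inv_pow, ha4, inv_one]
  refine ⟨12 * k, by positivity, ?_⟩
  rw [← QuotientGroup.eq_one_iff, ← QuotientGroup.mk'_apply, map_pow, ← ht]
  exact hb12

/-- **The commutator subgroup `[SL₂(ℤ), Γ(N)]` contains the normal closure of a power of `T`.**
For `N ≥ 1` there is `m ≥ 1` with `g Tᵐ g⁻¹ ∈ [SL₂(ℤ), Γ(N)]` for every `g ∈ SL₂(ℤ)`: so the (finite-index,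
normal) subgroup `[SL₂(ℤ), Γ(N)]` has finite Wohlfahrt level; it is a congruence subgroup iff it contains
`Γ(m')` for its level `m'` (Wohlfahrt), which is the content of `stub_hcor_invariant`.
[cite: CalegariDimitrovTang2025, Corollary 4.5.3] -/
theorem conj_T_pow_mem_commutator (N : ℕ) (hN : 0 < N) :
    ∃ m : ℕ, 0 < m ∧ ∀ g : SL(2, ℤ), g * ModularGroup.T ^ m * g⁻¹ ∈ ⁅(⊤ : Subgroup SL(2, ℤ)), Gamma N⁆ := by
  obtain ⟨m, hm, hT⟩ := exists_T_pow_mem_commutator N hN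
  haveI := Gamma_normal N
  haveI : (⁅(⊤ : Subgroup SL(2, ℤ)), Gamma N⁆).Normal := Subgroup.commutator_normal _ _
  exact ⟨m, hm, fun g ↦ Subgroup.Normal.conj_mem inferInstance _ hT g⟩

/-! ### Appendix (g40, second instalment): finite index of `[SL₂(ℤ), Γ(N)]` and the converse reduction -/

/-- **Uniform exponent.** For `N ≥ 1` there is `m ≥ 1` with `g ^ m ∈ [SL₂(ℤ), Γ(N)]` for EVERY `g ∈ SL₂(ℤ)`:
the transfer `V : E → Z(E)` of `E = SL₂(ℤ)/[SL₂(ℤ), Γ(N)]` (`V g = g^{[E:Z(E)]}`) takes values of order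
dividing `12` on the generators `S`, `T` (`S⁴ = 1`, `(ST)³ = S²`), hence on all of `E = ⟨S, T⟩`
(Mathlib `SpecialLinearGroup.SL2Z_generators`). [cite: CalegariDimitrovTang2025, §4.5 (`SL₂(ℤ)ᵃᵇ ≅ ℤ/12`)] -/
theorem exists_pow_mem_commutator (N : ℕ) (hN : 0 < N) :
    ∃ m : ℕ, 0 < m ∧ ∀ g : SL(2, ℤ), g ^ m ∈ ⁅(⊤ : Subgroup SL(2, ℤ)), Gamma N⁆ := by
  haveI : NeZero N := ⟨hN.ne'⟩
  haveI := Gamma_normal N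
  set C : Subgroup SL(2, ℤ) := ⁅(⊤ : Subgroup SL(2, ℤ)), Gamma N⁆ with hC
  haveI hCn : C.Normal := Subgroup.commutator_normal _ _
  have hcent : (Gamma N).map (QuotientGroup.mk' C) ≤ Subgroup.center (SL(2, ℤ) ⧸ C) := by
    rintro _ ⟨x, hx, rfl⟩
    rw [Subgroup.mem_center_iff]
    intro e
    obtain ⟨g, rfl⟩ := QuotientGroup.mk'_surjective C e
    have hc : g * x * g⁻¹ * x⁻¹ ∈ C := Subgroup.commutator_mem_commutator (Subgroup.mem_top g) hx
    have h1 : QuotientGroup.mk' C (g * x * g⁻¹ * x⁻¹) = 1 := (QuotientGroup.eq_one_iff _).mpr hc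
    rw [map_mul, map_mul, map_mul, map_inv, map_inv] at h1
    calc QuotientGroup.mk' C g * QuotientGroup.mk' C x
        = (QuotientGroup.mk' C g * QuotientGroup.mk' C x * (QuotientGroup.mk' C g)⁻¹ *
            (QuotientGroup.mk' C x)⁻¹) * (QuotientGroup.mk' C x * QuotientGroup.mk' C g) := by group
      _ = QuotientGroup.mk' C x * QuotientGroup.mk' C g := by rw [h1, one_mul]
  haveI : (Subgroup.center (SL(2, ℤ) ⧸ C)).FiniteIndex := by
    haveI : ((Gamma N).map (QuotientGroup.mk' C)).FiniteIndex := by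
      refine ⟨fun h0 ↦ ?_⟩
      have hd := Subgroup.index_map_dvd (Gamma N) (QuotientGroup.mk'_surjective C)
      rw [h0, zero_dvd_iff] at hd
      exact (Gamma N).index_ne_zero_of_finite hd
    exact Subgroup.finiteIndex_of_le hcent
  set k : ℕ := (Subgroup.center (SL(2, ℤ) ⧸ C)).index with hk
  have hk0 : 0 < k := Nat.pos_of_ne_zero Subgroup.FiniteIndex.index_ne_zero
  let V : (SL(2, ℤ) ⧸ C) →* Subgroup.center (SL(2, ℤ) ⧸ C) := MonoidHom.transferCenterPow (SL(2, ℤ) ⧸ C)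
  have hV : ∀ g, ((V g : Subgroup.center (SL(2, ℤ) ⧸ C)) : SL(2, ℤ) ⧸ C) = g ^ k :=
    MonoidHom.transferCenterPow_apply
  have hpow_mul : ∀ g h : SL(2, ℤ) ⧸ C, (g * h) ^ k = g ^ k * h ^ k := fun g h ↦ by
    have := congrArg Subtype.val (map_mul V g h)
    simpa only [hV, Subgroup.coe_mul] using this
  have hcen : ∀ g : SL(2, ℤ) ⧸ C, g ^ k ∈ Subgroup.center (SL(2, ℤ) ⧸ C) := fun g ↦ by
    rw [← hV]; exact (V g).2
  have hS4 : (ModularGroup.S : SL(2, ℤ)) ^ 4 = 1 := by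
    ext i j; fin_cases i <;> fin_cases j <;> simp [pow_succ, ModularGroup.S, Matrix.mul_apply, Fin.sum_univ_two]
  have hST : (ModularGroup.S * ModularGroup.T : SL(2, ℤ)) ^ 3 = ModularGroup.S ^ 2 := by
    ext i j; fin_cases i <;> fin_cases j <;>
      simp [pow_succ, ModularGroup.S, ModularGroup.T, Matrix.mul_apply, Fin.sum_univ_two]
  set s : SL(2, ℤ) ⧸ C := QuotientGroup.mk' C ModularGroup.S with hs
  set t : SL(2, ℤ) ⧸ C := QuotientGroup.mk' C ModularGroup.T with ht
  have hs4 : s ^ 4 = 1 := by rw [hs, ← map_pow, hS4, map_one]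
  have hst : (s * t) ^ 3 = s ^ 2 := by rw [hs, ht, ← map_mul, ← map_pow, hST, map_pow]
  have comm : Commute (s ^ k) (t ^ k) := (Subgroup.mem_center_iff.mp (hcen t) (s ^ k))
  have hab : (s ^ k) ^ 3 * (t ^ k) ^ 3 = (s ^ k) ^ 2 := by
    rw [← comm.mul_pow, ← hpow_mul, ← pow_mul, mul_comm k 3, pow_mul, hst, ← pow_mul, ← pow_mul,
      mul_comm 2 k]
  have ha4 : (s ^ k) ^ 4 = 1 := by rw [← pow_mul, mul_comm, pow_mul, hs4, one_pow]
  have hb3 : (t ^ k) ^ 3 = (s ^ k)⁻¹ := by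
    rw [show (t ^ k) ^ 3 = ((s ^ k) ^ 3)⁻¹ * ((s ^ k) ^ 3 * (t ^ k) ^ 3) by group, hab]
    group
  have hs12 : s ^ (12 * k) = 1 := by
    rw [show 12 * k = 4 * (3 * k) by ring, pow_mul, hs4, one_pow]
  have ht12 : t ^ (12 * k) = 1 := by
    calc t ^ (12 * k) = ((t ^ k) ^ 3) ^ 4 := by rw [← pow_mul, ← pow_mul]; ring_nf
      _ = 1 := by rw [hb3, inv_pow, ha4, inv_one]
  -- closure induction over `SL₂(ℤ) = ⟨S, T⟩`
  have hall : ∀ g : SL(2, ℤ), (QuotientGroup.mk' C g) ^ (12 * k) = 1 := by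
    intro g
    have hg : g ∈ Subgroup.closure {ModularGroup.S, ModularGroup.T} := by
      rw [SpecialLinearGroup.SL2Z_generators]; trivial
    induction hg using Subgroup.closure_induction with
    | mem x hx =>
      simp only [Set.mem_insert_iff, Set.mem_singleton_iff] at hx
      rcases hx with rfl | rfl
      · exact hs12
      · exact ht12
    | one => rw [map_one, one_pow]
    | mul x y _ _ ihx ihy =>
      have cxy : Commute ((QuotientGroup.mk' C x) ^ k) ((QuotientGroup.mk' C y) ^ k) :=
        (Subgroup.mem_center_iff.mp (hcen _) _)
      rw [map_mul, mul_comm 12 k, pow_mul, hpow_mul, cxy.mul_pow, ← pow_mul, ← pow_mul,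
        mul_comm k 12, ihx, ihy, one_mul]
    | inv x _ ihx => rw [map_inv, inv_pow, ihx, inv_one]
  refine ⟨12 * k, by positivity, fun g ↦ ?_⟩
  rw [← QuotientGroup.eq_one_iff, ← QuotientGroup.mk'_apply, map_pow]
  exact hall g

/-- **`[SL₂(ℤ), Γ(N)]` has finite index in `SL₂(ℤ)`** (`N ≥ 1`): `Γ(N)/([SL₂(ℤ),Γ(N)] ∩ Γ(N))` is a finitely
generated (Schreier) abelian group of finite exponent, hence finite. [cite: CalegariDimitrovTang2025, §4.5] -/
theorem commutator_finiteIndex (N : ℕ) (hN : 0 < N) : (⁅(⊤ : Subgroup SL(2, ℤ)), Gamma N⁆).FiniteIndex := by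
  haveI : NeZero N := ⟨hN.ne'⟩
  haveI := Gamma_normal N
  set C : Subgroup SL(2, ℤ) := ⁅(⊤ : Subgroup SL(2, ℤ)), Gamma N⁆ with hC
  haveI hCn : C.Normal := Subgroup.commutator_normal _ _
  obtain ⟨m, hm, hpow⟩ := exists_pow_mem_commutator N hN
  -- `Γ(N) / (C ∩ Γ(N))` is finite
  let C' : Subgroup (Gamma N) := C.subgroupOf (Gamma N)
  haveI : C'.Normal := Subgroup.Normal.subgroupOf hCn _
  haveI : Group.FG SL(2, ℤ) :=
    Group.fg_iff.mpr ⟨{ModularGroup.S, ModularGroup.T}, SpecialLinearGroup.SL2Z_generators, by simp⟩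
  haveI : Group.FG (Gamma N) := Subgroup.fg_of_index_ne_zero (Gamma N)
  haveI : Group.FG (Gamma N ⧸ C') := QuotientGroup.fg C'
  have hcomm : ∀ a b : Gamma N ⧸ C', a * b = b * a := by
    intro a b
    induction a using QuotientGroup.induction_on with | H a =>
    induction b using QuotientGroup.induction_on with | H b =>
    rw [← QuotientGroup.mk_mul, ← QuotientGroup.mk_mul, QuotientGroup.eq, Subgroup.mem_subgroupOf]
    have : ((a * b)⁻¹ * (b * a) : Gamma N) = (b⁻¹ : Gamma N) * (a⁻¹ * b * a) := by group
    rw [this]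
    push_cast
    have h1 : (a : SL(2, ℤ))⁻¹ * b * a * (b : SL(2, ℤ))⁻¹ ∈ C := by
      have := Subgroup.commutator_mem_commutator (H₁ := (⊤ : Subgroup SL(2, ℤ))) (H₂ := Gamma N)
        (Subgroup.mem_top ((a : SL(2, ℤ))⁻¹)) b.2
      simpa [commutatorElement_def] using this
    have h2 : (b : SL(2, ℤ))⁻¹ * ((a : SL(2, ℤ))⁻¹ * b * a) =
        (b : SL(2, ℤ))⁻¹ * ((a : SL(2, ℤ))⁻¹ * b * a * (b : SL(2, ℤ))⁻¹) * b := by group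
    rw [h2]
    exact hCn.conj_mem' _ h1 _
  letI : CommGroup (Gamma N ⧸ C') := { (inferInstance : Group (Gamma N ⧸ C')) with mul_comm := hcomm }
  have htors : Monoid.IsTorsion (Gamma N ⧸ C') := by
    intro q
    induction q using QuotientGroup.induction_on with | H x =>
    refine isOfFinOrder_iff_pow_eq_one.mpr ⟨m, hm, ?_⟩
    rw [← QuotientGroup.mk_pow, QuotientGroup.eq_one_iff, Subgroup.mem_subgroupOf, SubgroupClass.coe_pow]
    exact hpow _
  haveI : Finite (Gamma N ⧸ C') := CommGroup.finite_of_fg_torsion _ htors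
  -- index bookkeeping: `[SL₂(ℤ) : C] = [Γ(N) : C ∩ Γ(N)] · [SL₂(ℤ) : Γ(N)]`
  refine ⟨?_⟩
  have hle : C ≤ Gamma N := Subgroup.commutator_le_right _ _
  rw [← Subgroup.relIndex_mul_index hle]
  refine mul_ne_zero ?_ (Gamma N).index_ne_zero_of_finite
  rw [Subgroup.relIndex]
  exact C'.index_ne_zero_of_finite

/-- **The converse reduction: `stub_hcor_invariant` ⟹ «`[SL₂(ℤ), Γ(N)]` is a congruence subgroup».**  Apply
the stub to the quotient map `Γ(N) → Γ(N)/([SL₂(ℤ),Γ(N)] ∩ Γ(N))`, a conjugation-invariant homomorphism to a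
FINITE ABELIAN group (`commutator_finiteIndex`).  With `hcor_invariant_of_commutator_congruence` this makes
the reformulation «∀ N ≥ 1 ∃ M ≠ 0, Γ(M) ∩ Γ(N) ≤ [SL₂(ℤ), Γ(N)]» EXACTLY equivalent to the stub
(CDT Cor. 4.5.3 in invariant form). [cite: CalegariDimitrovTang2025, Corollary 4.5.3 and Theorem 4.5.2] -/
theorem commutator_congruence_of_hcor_invariant
    (hinv : ∀ (N : ℕ) (Q : Type) [CommGroup Q] [Finite Q] (θ : Gamma N →* Q),
      (∀ (g x : SL(2, ℤ)) (hx : x ∈ Gamma N) (hgx : g * x * g⁻¹ ∈ Gamma N),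
        θ ⟨g * x * g⁻¹, hgx⟩ = θ ⟨x, hx⟩) →
      ∃ M : ℕ, M ≠ 0 ∧ ∀ (x : SL(2, ℤ)) (hx : x ∈ Gamma N), x ∈ Gamma M → θ ⟨x, hx⟩ = 1) :
    ∀ N : ℕ, 0 < N → ∃ M : ℕ, M ≠ 0 ∧ Gamma M ⊓ Gamma N ≤ ⁅(⊤ : Subgroup SL(2, ℤ)), Gamma N⁆ := by
  intro N hN
  haveI : NeZero N := ⟨hN.ne'⟩
  haveI := Gamma_normal N
  set C : Subgroup SL(2, ℤ) := ⁅(⊤ : Subgroup SL(2, ℤ)), Gamma N⁆ with hC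
  haveI hCn : C.Normal := Subgroup.commutator_normal _ _
  obtain ⟨m, hm, hpow⟩ := exists_pow_mem_commutator N hN
  let C' : Subgroup (Gamma N) := C.subgroupOf (Gamma N)
  haveI : C'.Normal := Subgroup.Normal.subgroupOf hCn _
  haveI : Group.FG SL(2, ℤ) :=
    Group.fg_iff.mpr ⟨{ModularGroup.S, ModularGroup.T}, SpecialLinearGroup.SL2Z_generators, by simp⟩
  haveI : Group.FG (Gamma N) := Subgroup.fg_of_index_ne_zero (Gamma N)
  haveI : Group.FG (Gamma N ⧸ C') := QuotientGroup.fg C'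
  have hcomm : ∀ a b : Gamma N ⧸ C', a * b = b * a := by
    intro a b
    induction a using QuotientGroup.induction_on with | H a =>
    induction b using QuotientGroup.induction_on with | H b =>
    rw [← QuotientGroup.mk_mul, ← QuotientGroup.mk_mul, QuotientGroup.eq, Subgroup.mem_subgroupOf]
    have : ((a * b)⁻¹ * (b * a) : Gamma N) = (b⁻¹ : Gamma N) * (a⁻¹ * b * a) := by group
    rw [this]
    push_cast
    have h1 : (a : SL(2, ℤ))⁻¹ * b * a * (b : SL(2, ℤ))⁻¹ ∈ C := by
      have := Subgroup.commutator_mem_commutator (H₁ := (⊤ : Subgroup SL(2, ℤ))) (H₂ := Gamma N)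
        (Subgroup.mem_top ((a : SL(2, ℤ))⁻¹)) b.2
      simpa [commutatorElement_def] using this
    have h2 : (b : SL(2, ℤ))⁻¹ * ((a : SL(2, ℤ))⁻¹ * b * a) =
        (b : SL(2, ℤ))⁻¹ * ((a : SL(2, ℤ))⁻¹ * b * a * (b : SL(2, ℤ))⁻¹) * b := by group
    rw [h2]
    exact hCn.conj_mem' _ h1 _
  letI : CommGroup (Gamma N ⧸ C') := { (inferInstance : Group (Gamma N ⧸ C')) with mul_comm := hcomm }
  have htors : Monoid.IsTorsion (Gamma N ⧸ C') := by
    intro q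
    induction q using QuotientGroup.induction_on with | H x =>
    refine isOfFinOrder_iff_pow_eq_one.mpr ⟨m, hm, ?_⟩
    rw [← QuotientGroup.mk_pow, QuotientGroup.eq_one_iff, Subgroup.mem_subgroupOf, SubgroupClass.coe_pow]
    exact hpow _
  haveI : Finite (Gamma N ⧸ C') := CommGroup.finite_of_fg_torsion _ htors
  -- the quotient map is conjugation invariant
  let θ : Gamma N →* (Gamma N ⧸ C') := QuotientGroup.mk' C'
  have hθ : ∀ (g x : SL(2, ℤ)) (hx : x ∈ Gamma N) (hgx : g * x * g⁻¹ ∈ Gamma N),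
      θ ⟨g * x * g⁻¹, hgx⟩ = θ ⟨x, hx⟩ := by
    intro g x hx hgx
    rw [QuotientGroup.mk'_apply, QuotientGroup.mk'_apply, QuotientGroup.eq, Subgroup.mem_subgroupOf]
    push_cast
    have h1 : g * x * g⁻¹ * x⁻¹ ∈ C := Subgroup.commutator_mem_commutator (Subgroup.mem_top g) hx
    have h2 : (g * x * g⁻¹)⁻¹ * x = (g * x * g⁻¹)⁻¹ * (g * x * g⁻¹ * x⁻¹)⁻¹ * (g * x * g⁻¹) := by group
    rw [h2]
    exact hCn.conj_mem' _ (C.inv_mem h1) _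
  obtain ⟨M, hM, hker⟩ := hinv N (Gamma N ⧸ C') θ hθ
  refine ⟨M, hM, fun x hx ↦ ?_⟩
  have h := hker x hx.2 hx.1
  rw [QuotientGroup.mk'_apply, QuotientGroup.eq_one_iff, Subgroup.mem_subgroupOf] at h
  exact h

end Summit.BirchSwinnertonDyer.BirchSwinnertonDyer.Theorems.StarredOptimalManinUnitFiveSevenHcorReduction

end
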